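import Summits.Schanuel.Schanuel.Theorems.RootDecomp1KW4Dossier01

/-! PORT (census-1 g29, ×0 RECORD PORT of the census's own kernel scratch «RAMIF-v1 (B) — the CLASS SPLIT of W4 level points at
 m₀ = 2» (INSTRUMENT NOTE 72 L3351; crit g14 audit L3352 (B): identity / trichotomy / point table / congruence classes / thresholds
 re-checked, «ARITHMETIC SOUND», ×0 STRUCTURE datum; kernel scratch HOME/census/tools/gen29/scratch/W4Coprime.lean sha256
 0f91a57d184140df…, 421 l, INSTRUMENT NOTE 74 L3363; writer g40 NOTE 21 L3364 re-check with a re-hash and a planted-false control;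
 crit ACK + PORT GO L3366 «×0 RECORD, NODE-34 TERMS», own CTRL + three PROBES: the headline re-threaded into the exact clause shape of
 the tree's `ThinFibreAt 2 W4P`, `ThinFibreAt 2 W4P ↔ clause` by `Iff.rfl`, numerics at the level-0 point (1/2, 1)) — part 1 of 2
 (RootDecomp1KW4Coprime01): §1 integer algebra (levelE / levelE0 / Hint, the identity), §2 the integer level equation from `bev_W4P`,
 §3 `2^{N!} ≤ p_N`, §4 the structure of a coprime-class level point and the trailing-coefficient divisibilities. PORT EDITS (declared,
 port-side): (m1) the scratch's `partialSum_two` DELETED-FOR-TWIN, its one use re-pointed to the tree's `RootDecomp1KLevelFinite.lac_partialSum_two`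
 (LevelFinite12 l.82, same statement and proof); (m2) the scratch's `isCoprime_num_den` moved to part 02 as a PRIVATE copy (verbatim twin of
 `Literature.NumberTheory.DiophantineApproximation.SparseDyadicRationals.isCoprime_num_den`; LevelFinite01/03/04/08/09 precedent); statements and
 proofs otherwise VERBATIM from the scratch. `--supports stmt-Schanuel-33364`; no census credit; ×0 record port; does NOT prove `ThinFibreAt 2 W4P`
 / `LevelFinite W4P` / stmt-Schanuel-33364; row 36 UNDECIDED OF RECORD. -/

/-!
# RootDecomp1KW4Coprime — the `m₀ = 2` thin-fibre clause for the standing witness W4 ON THE COPRIME CLASS of level points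
(census-1 g29; hypothesis-free, elementary; a PARTIAL statement, ×0)

`W4P = (Y⁴ − 17)·x² + (Y³ + 1)·x + (Y + 2)` (tree `RootDecomp1KOddEmpty.W4P`) is the record's standing witness of the open territory at
`m₀ = 2` (LIVENESS row 36, UNDECIDED OF RECORD: `ThinFibreAt 2 W4P` / `LevelFinite W4P` hypothesis-free is binder territory —
`PadicSubspace`, Schlickewei's p-adic Subspace Theorem with `n = 3`).  For a level point `(s_N, r)` of `W4P` (`s_N = p_N/2^{N!}`,
`p_N = psNumer 2 N`, `r = a/b` in lowest terms) the level equation cleared of denominators is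
`levelE a b p_N 2^{N!} = 0` (§2).  It forces `b ∣ p_N²`, and at an odd prime `q ∣ b` either `v_q(p_N) = v_q(b)` (the point meets the
branch `x ~ −1/Y` of the node `(0, ∞)`) or `v_q(p_N) = 2·v_q(b)` (the branch `x ~ −1/Y²`).  THE COPRIME CLASS: `p_N = b·c` with
`gcd(b, c) = 1` (the second kind of prime absent).  On it (§4): `c ∣ a + 2b` (`=: j·c`, `j ≠ 0`), `b ∣ jc² + 2^{N!}`,
`c ∣ j·2^{N!} − 7b²`, so `m := (j²c² + j·2^{N!} − 7b²)/p_N ∈ ℤ`, and the IDENTITY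
`j²·levelE (jc − 2b) b (bc) T = b³c²j·Hint j m b c` (whenever `jT = −j²c² + mbc + 7b²`; it is
`q(λ)²·W4P(jλ/q(λ), jλ − 2) = j·λ²·H_{j,m}(λ)` at `λ = c/b`, `q = −j²λ² + mλ + 7`) gives `Hint j m b c = 0` for the cubic
`H_{j,m}(λ) = j³(m−j)λ³ + j²(19j−8m)λ² + (m²+12jm−81j²)λ + (83j+7m)`; the trailing coefficients then give `c ∣ 83j + 7m ≠ 0`
or (`83j + 7m = 0`) `c ∣ m² + 12jm − 81j² ≠ 0`.  Part 02 turns the sizes `|j|·c ≤ (C+2)·b`, `|m|·c ≤ K₁·b` into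
`c⁶ ≤ K·b⁴`, i.e. `2^{6·N!} ≤ p_N⁶ ≤ K·b¹⁰`, and the tree's `RootDecomp1KRunge.runge_arith` (`10 + 1 ≤ 6·2`) yields the clause
`C·2^{(N+1)!} < b^{2N}` for `N ≥ N₀(C)`.  MECHANISM (for the record): `m/j = ψ(P)` for the degree-3 function
`ψ = (Y+2) + 1/x − 7/(Y+2)` with polar divisor `2·∞₂ + (−7,−2)`; on the coprime class the point is integral with respect to the
rational point `∞₂` at every place — a «trivial Runge» class —, `H_{j,m}` is the fibre `ψ = m/j`.  The complementary class
(`∃` odd `q ∣ b` with `q² ∣ p_N`) is untouched and is not thin by congruences.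

Rung 0: nothing here proves Schanuel, stmt-Schanuel-33364 / 33363 / 31077 / 31987, `ThinFibre 2`, `ThinFibreAt 2 W4P` or
`LevelFinite W4P`.  No Literature import, no fact def, no sorry, no set_option.
-/

noncomputable section

open Polynomial LiouvilleNumber
open scoped Nat

namespace Summit.Schanuel.Schanuel.Theorems.RootDecomp1KW4Coprime

open Summit.Schanuel.Schanuel.Theorems.RootDecomp1KTwoBaseCell (psNumer partialSum_eq_psNumer_div coprime_psNumer)
open Summit.Schanuel.Schanuel.Theorems.RootDecomp1KDegreeLadder
open Summit.Schanuel.Schanuel.Theorems.RootDecomp1KOddEmpty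
open Summit.Schanuel.Schanuel.Theorems.RootDecomp1KRunge (runge_arith psNumer_pos_runge)
open Summit.Schanuel.Schanuel.Theorems.RootDecomp1KLevelFinite (lac_partialSum_two)

/-! ### §1 Integer algebra -/

/-- the level equation cleared of denominators: `b⁴·T²·W4P(p/T, a/b)`. -/
def levelE (a b p T : ℤ) : ℤ :=
  (a ^ 4 - 17 * b ^ 4) * p ^ 2 + (a ^ 3 * b + b ^ 4) * p * T + (a * b ^ 3 + 2 * b ^ 4) * T ^ 2

/-- the level equation divided by `b²` when `p = b·c`: `levelE a b (b·c) T = b²·levelE0 a b c T`. -/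
def levelE0 (a b c T : ℤ) : ℤ :=
  (a ^ 4 - 17 * b ^ 4) * c ^ 2 + (a ^ 3 + b ^ 3) * c * T + (a + 2 * b) * b * T ^ 2

/-- the cubic `H_{j,m}` cleared of denominators: `b³·H_{j,m}(c/b)`. -/
def Hint (j m b c : ℤ) : ℤ :=
  j ^ 3 * (m - j) * c ^ 3 + j ^ 2 * (19 * j - 8 * m) * c ^ 2 * b + (m ^ 2 + 12 * j * m - 81 * j ^ 2) * c * b ^ 2
    + (83 * j + 7 * m) * b ^ 3

/-- `levelE a b (bc) T = b²·levelE0 a b c T`. -/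
theorem levelE_eq (a b c T : ℤ) : levelE a b (b * c) T = b ^ 2 * levelE0 a b c T := by
  unfold levelE levelE0; ring

/-- THE IDENTITY: `j²·E(jc − 2b, b, bc, T) = b³c²j·H` whenever `jT = −j²c² + mbc + 7b²`
(i.e. `q(λ)²·W4P(jλ/q(λ), jλ − 2) = j·λ²·H_{j,m}(λ)` at `λ = c/b`). -/
theorem key_identity (j m b c T : ℤ) (hT : j * T = -j ^ 2 * c ^ 2 + m * b * c + 7 * b ^ 2) :
    j ^ 2 * levelE (j * c - 2 * b) b (b * c) T = b ^ 3 * c ^ 2 * j * Hint j m b c := by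
  have h1 : j ^ 2 * levelE (j * c - 2 * b) b (b * c) T =
      j ^ 2 * (((j * c - 2 * b) ^ 4 - 17 * b ^ 4) * (b * c) ^ 2) +
        j * (((j * c - 2 * b) ^ 3 * b + b ^ 4) * (b * c)) * (j * T) +
        ((j * c - 2 * b) * b ^ 3 + 2 * b ^ 4) * (j * T) ^ 2 := by
    unfold levelE; ring
  rw [h1, hT]; unfold Hint; ring

/-! ### §2 From the real level equation to `levelE = 0` -/

/-- a level point `(s_N, r)` of `W4P` satisfies the integer level equation `levelE (num r) (den r) p_N 2^{N!} = 0`. -/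
theorem levelE_eq_zero {N : ℕ} {r : ℚ} (h : bev W4P (partialSum 2 N) r = 0) :
    levelE r.num r.den (psNumer 2 N) (2 ^ N !) = 0 := by
  have hb : (r.den : ℝ) ≠ 0 := by exact_mod_cast r.den_ne_zero
  have h2 : ((2 : ℝ) ^ N !) ≠ 0 := by positivity
  have hr : (r : ℝ) = (r.num : ℝ) / (r.den : ℝ) := by rw [Rat.cast_def]
  rw [bev_W4P, lac_partialSum_two, hr] at h
  have key : ((levelE r.num r.den (psNumer 2 N) (2 ^ N !) : ℤ) : ℝ) =
      ((r.den : ℝ) ^ 4 * ((2 : ℝ) ^ N !) ^ 2) *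
        (((psNumer 2 N : ℝ) / 2 ^ N !) ^ 2 * (((r.num : ℝ) / r.den) ^ 4 - 17) +
          (psNumer 2 N : ℝ) / 2 ^ N ! * (((r.num : ℝ) / r.den) ^ 3 + 1) + ((r.num : ℝ) / r.den + 2)) := by
    unfold levelE; push_cast; field_simp
  rw [h, mul_zero] at key
  exact_mod_cast key

/-! ### §3 Small facts -/

/-- `2^{N!} ≤ p_N` for `N ≥ 1` (the terms `i = 0, 1` of `p_N = Σ_{i ≤ N} 2^{N! − i!}` already give `2^{N!}`), i.e. `s_N ≥ 1`. -/
theorem two_pow_le_psNumer {N : ℕ} (hN : 1 ≤ N) : 2 ^ Nat.factorial N ≤ psNumer 2 N := by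
  unfold psNumer
  have hsub : ({0, 1} : Finset ℕ) ⊆ Finset.range (N + 1) := by
    intro i hi
    simp only [Finset.mem_insert, Finset.mem_singleton] at hi
    rcases hi with rfl | rfl
    · simp
    · simp only [Finset.mem_range]; omega
  have hf : 1 ≤ Nat.factorial N := Nat.succ_le_of_lt (Nat.factorial_pos N)
  have hpair : ∑ i ∈ ({0, 1} : Finset ℕ), 2 ^ (Nat.factorial N - Nat.factorial i) = 2 ^ Nat.factorial N := by
    rw [Finset.sum_pair (by norm_num)]
    simp only [Nat.factorial_zero, Nat.factorial_one]
    have e : Nat.factorial N = (Nat.factorial N - 1) + 1 := by omega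
    conv_rhs => rw [e]
    ring
  calc 2 ^ Nat.factorial N = ∑ i ∈ ({0, 1} : Finset ℕ), 2 ^ (Nat.factorial N - Nat.factorial i) := hpair.symm
    _ ≤ ∑ i ∈ Finset.range (N + 1), 2 ^ (Nat.factorial N - Nat.factorial i) :=
        Finset.sum_le_sum_of_subset hsub

/-! ### §4 The structure of a coprime-class level point -/

/-- From `levelE a b (bc) T = 0` with `b, c, T > 0`, `gcd(b,c) = gcd(a,b) = gcd(c,T) = gcd(b,T) = 1`:
integers `j ≠ 0`, `m` with `a + 2b = jc` and `Hint j m b c = 0`. -/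
theorem structure_of_level {a b c T : ℤ} (hb : 0 < b) (hc : 0 < c) (hT0 : 0 < T)
    (hE : levelE a b (b * c) T = 0) (hbc : IsCoprime b c) (hab : IsCoprime a b) (hcT : IsCoprime c T) :
    ∃ j m : ℤ, j ≠ 0 ∧ a + 2 * b = j * c ∧ m * (b * c) = j ^ 2 * c ^ 2 + j * T - 7 * b ^ 2 ∧
      Hint j m b c = 0 := by
  have hb0 : b ≠ 0 := hb.ne'
  have hc0 : c ≠ 0 := hc.ne'
  have hE0 : levelE0 a b c T = 0 := by
    have := levelE_eq a b c T
    rw [hE] at this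
    rcases mul_eq_zero.mp this.symm with h | h
    · exact absurd (pow_eq_zero_iff (two_ne_zero)|>.mp h) hb0
    · exact h
  -- (i) c ∣ a + 2b
  have h1 : c ∣ (a + 2 * b) * (b * T ^ 2) := by
    refine ⟨-((a ^ 4 - 17 * b ^ 4) * c + (a ^ 3 + b ^ 3) * T), ?_⟩
    have : levelE0 a b c T = 0 := hE0
    unfold levelE0 at this
    linear_combination this
  have hcbT : IsCoprime c (b * T ^ 2) := (hbc.symm).mul_right (hcT.pow_right)
  obtain ⟨j, hj⟩ := hcbT.dvd_of_dvd_mul_right h1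
  -- hj : a + 2 * b = c * j
  have ha : a = j * c - 2 * b := by linarith
  -- j ≠ 0
  have hj0 : j ≠ 0 := by
    rintro rfl
    have ha' : a = -2 * b := by linarith
    have : levelE a b (b * c) T = -(b ^ 4 * (b * c) * (b * c + 7 * T)) := by
      rw [ha']; unfold levelE; ring
    rw [hE] at this
    have hpos : 0 < b ^ 4 * (b * c) * (b * c + 7 * T) := by positivity
    linarith
  -- (ii) b ∣ j c² + T
  have h2 : b ∣ c * a ^ 3 * (a * c + T) := by
    refine ⟨-(-17 * b ^ 3 * c ^ 2 + b ^ 2 * c * T + (a + 2 * b) * T ^ 2), ?_⟩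
    have : levelE0 a b c T = 0 := hE0
    unfold levelE0 at this
    linear_combination this
  have hbca : IsCoprime b (c * a ^ 3) := hbc.mul_right (hab.symm.pow_right)
  have h2' : b ∣ a * c + T := hbca.dvd_of_dvd_mul_left h2
  have h3 : b ∣ j * c ^ 2 + T := by
    have e : j * c ^ 2 + T = (a * c + T) + 2 * c * b := by rw [ha]; ring
    rw [e]; exact dvd_add h2' (Dvd.intro_left _ rfl)
  -- (iii) c ∣ j T − 7 b²
  have hE1 : (a ^ 4 - 17 * b ^ 4) * c + (a ^ 3 + b ^ 3) * T + j * b * T ^ 2 = 0 := by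
    have : levelE0 a b c T = c * ((a ^ 4 - 17 * b ^ 4) * c + (a ^ 3 + b ^ 3) * T + j * b * T ^ 2) := by
      unfold levelE0; rw [hj]; ring
    rw [hE0] at this
    rcases mul_eq_zero.mp this.symm with h | h
    · exact absurd h hc0
    · exact h
  have h4 : c ∣ b * T * (j * T - 7 * b ^ 2) := by
    refine ⟨-((a ^ 4 - 17 * b ^ 4) + j * (a ^ 2 - 2 * a * b + 4 * b ^ 2) * T), ?_⟩
    have e : (a ^ 3 + b ^ 3) * T + j * b * T ^ 2 - b * T * (j * T - 7 * b ^ 2) =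
        c * (j * (a ^ 2 - 2 * a * b + 4 * b ^ 2) * T) := by
      have : a ^ 3 + 8 * b ^ 3 = (a + 2 * b) * (a ^ 2 - 2 * a * b + 4 * b ^ 2) := by ring
      linear_combination T * this + T * (a ^ 2 - 2 * a * b + 4 * b ^ 2) * hj
    linear_combination hE1 - e
  have hcbT' : IsCoprime c (b * T) := (hbc.symm).mul_right hcT
  have h4' : c ∣ j * T - 7 * b ^ 2 := hcbT'.dvd_of_dvd_mul_left h4
  -- (iv) m
  have h5 : b * c ∣ j ^ 2 * c ^ 2 + j * T - 7 * b ^ 2 := by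
    refine hbc.mul_dvd ?_ ?_
    · have e : j ^ 2 * c ^ 2 + j * T - 7 * b ^ 2 = j * (j * c ^ 2 + T) - 7 * b * b := by ring
      rw [e]; exact dvd_sub (dvd_mul_of_dvd_right h3 _) (Dvd.intro_left _ rfl)
    · have e : j ^ 2 * c ^ 2 + j * T - 7 * b ^ 2 = j ^ 2 * c * c + (j * T - 7 * b ^ 2) := by ring
      rw [e]; exact dvd_add (Dvd.intro_left _ rfl) h4'
  obtain ⟨m, hm⟩ := h5
  have hT : j * T = -j ^ 2 * c ^ 2 + m * b * c + 7 * b ^ 2 := by linear_combination hm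
  -- (v) the identity
  have hid := key_identity j m b c T hT
  rw [← ha, hE, mul_zero] at hid
  have : Hint j m b c = 0 := by
    have hne : b ^ 3 * c ^ 2 * j ≠ 0 := by positivity
    rcases mul_eq_zero.mp hid.symm with h | h
    · exact absurd h hne
    · exact h
  exact ⟨j, m, hj0, by rw [hj]; ring, by linear_combination -hm, this⟩

/-- The trailing-coefficient consequence: `c` divides `83j + 7m`, or (when that vanishes) `m² + 12jm − 81j²`,
and the relevant coefficient is non-zero. -/
theorem trailing_dvd {j m b c : ℤ} (hj0 : j ≠ 0) (hc : 0 < c) (hbc : IsCoprime b c) (hH : Hint j m b c = 0) :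
    (83 * j + 7 * m ≠ 0 ∧ c ∣ 83 * j + 7 * m) ∨
      (83 * j + 7 * m = 0 ∧ m ^ 2 + 12 * j * m - 81 * j ^ 2 ≠ 0 ∧ c ∣ m ^ 2 + 12 * j * m - 81 * j ^ 2) := by
  have hc0 : c ≠ 0 := hc.ne'
  by_cases h0 : 83 * j + 7 * m = 0
  · right
    refine ⟨h0, ?_, ?_⟩
    · intro h1
      have e : (49 : ℤ) * (m ^ 2 + 12 * j * m - 81 * j ^ 2) = -4052 * j ^ 2 := by
        linear_combination (7 * m + j) * h0
      rw [h1, mul_zero] at e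
      have : j ^ 2 = 0 := by linarith
      exact hj0 (pow_eq_zero_iff two_ne_zero |>.mp this)
    · have hinner : j ^ 3 * (m - j) * c ^ 2 + j ^ 2 * (19 * j - 8 * m) * c * b +
          (m ^ 2 + 12 * j * m - 81 * j ^ 2) * b ^ 2 = 0 := by
        have e : Hint j m b c = c * (j ^ 3 * (m - j) * c ^ 2 + j ^ 2 * (19 * j - 8 * m) * c * b +
            (m ^ 2 + 12 * j * m - 81 * j ^ 2) * b ^ 2) + (83 * j + 7 * m) * b ^ 3 := by unfold Hint; ring
        rw [hH, h0, zero_mul, add_zero] at e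
        rcases mul_eq_zero.mp e.symm with h | h
        · exact absurd h hc0
        · exact h
      have hdvd : c ∣ (m ^ 2 + 12 * j * m - 81 * j ^ 2) * b ^ 2 := by
        refine ⟨-(j ^ 3 * (m - j) * c + j ^ 2 * (19 * j - 8 * m) * b), ?_⟩
        linear_combination hinner
      exact (hbc.symm.pow_right).dvd_of_dvd_mul_right hdvd
  · left
    refine ⟨h0, ?_⟩
    have hdvd : c ∣ (83 * j + 7 * m) * b ^ 3 := by
      refine ⟨-(j ^ 3 * (m - j) * c ^ 2 + j ^ 2 * (19 * j - 8 * m) * c * b +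
          (m ^ 2 + 12 * j * m - 81 * j ^ 2) * b ^ 2), ?_⟩
      have e : Hint j m b c = 0 := hH
      unfold Hint at e
      linear_combination e
    exact (hbc.symm.pow_right).dvd_of_dvd_mul_right hdvd

end Summit.Schanuel.Schanuel.Theorems.RootDecomp1KW4Coprime

end
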